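import Mathlib.Analysis.SpecialFunctions.Pow.Deriv
import Mathlib.Analysis.SpecialFunctions.Complex.Arg
import Mathlib.Analysis.Calculus.MeanValue
import HarnessLib

/-!
# The damping factor `exp(-a (1 - iz)^{1/2})` on the upper half-plane

Topic `Literature/Analysis/Fourier`. Elementary facts about the holomorphic function
`E(z) = exp(-a (1 - iz)^{1/2})` (`a > 0`, principal branch), which on every horizontal line of
the closed upper half-plane is bounded by `exp(-(a/2) ⟨x⟩^{1/2})`, `⟨x⟩^{1/2} = (1+x²)^{1/4}`:
it replaces the factor `exp(-⟨ξ⟩^{1/2})` of the Bourgain–Dyatlov weight (Ann. of Math. 187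
(2018), §3.1) in the explicit multiplier construction of Jin–Zhang (arXiv:1710.00250, §3), where
the weight must be realised as the boundary modulus of a holomorphic function with Lipschitz
boundary phase:

* `differentiableAt_sqrtDamping` — holomorphy on `{Im z > -1}`;
* `norm_sqrtDamping_le`, `norm_sqrtDamping_le_one`, `norm_sqrtDamping_real_ge` — the bounds
  `‖E(x+iy)‖ ≤ exp(-(a/2)(1+x²)^{1/4})` (`y ≥ 0`), `‖E‖ ≤ 1`, `‖E(x)‖ ≥ e^{-2a}` (`|x| ≤ 1`);
* `sqrtDamping_real_eq_norm_mul_exp` — on the real line `E(x) = ‖E(x)‖ e^{i b(x)}` with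
  `b(x) = -a Im (1 - ix)^{1/2}`;
* `abs_sqrtDamping_phase_sub_le` — the phase `b` is `(a/2)`-Lipschitz.

All statements are folklore; no definitions are introduced.
-/

namespace Literature.Analysis.Fourier

open _root_.Complex Set Filter
open scoped Real Topology ComplexConjugate

section SqrtDamping

/-- `1 - iz` has real part `1 + Im z` and imaginary part `-Re z`. [folklore] -/
theorem one_sub_I_mul_re_im (z : ℂ) : (1 - I * z).re = 1 + z.im ∧ (1 - I * z).im = -z.re := by
  constructor <;> simp

/-- `1 - iz` lies in the slit plane when `Im z > -1`. [folklore] -/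
theorem one_sub_I_mul_mem_slitPlane {z : ℂ} (hz : -1 < z.im) : 1 - I * z ∈ slitPlane := by
  rw [mem_slitPlane_iff]
  left
  rw [(one_sub_I_mul_re_im z).1]
  linarith

/-- `‖1 - iz‖² = (1 + Im z)² + (Re z)²`. [folklore] -/
theorem norm_sq_one_sub_I_mul (z : ℂ) : ‖1 - I * z‖ ^ 2 = (1 + z.im) ^ 2 + z.re ^ 2 := by
  rw [Complex.sq_norm, Complex.normSq_apply, (one_sub_I_mul_re_im z).1, (one_sub_I_mul_re_im z).2]
  ring

/-- **Real part of the principal square root**: `Re w^{1/2} ≥ √(‖w‖/2)` whenever `Re w ≥ 0`.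
[folklore] -/
theorem sqrt_norm_div_two_le_re_cpow_half {w : ℂ} (hw : 0 ≤ w.re) :
    Real.sqrt (‖w‖ / 2) ≤ (w ^ (2⁻¹ : ℂ)).re := by
  set q : ℂ := w ^ (2⁻¹ : ℂ) with hq
  have hq2 : q ^ 2 = w := by rw [hq]; exact cpow_ofNat_inv_pow w 2
  -- `Re q ≥ 0` (principal branch)
  have hre0 : 0 ≤ q.re := by
    by_cases hw0 : w = 0
    · rw [hq, hw0, zero_cpow (by norm_num)]
      simp
    · rw [hq, cpow_def_of_ne_zero hw0, exp_re]
      refine mul_nonneg (Real.exp_pos _).le (Real.cos_nonneg_of_mem_Icc ⟨?_, ?_⟩)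
      · have h1 : -π < arg w := neg_pi_lt_arg w
        have : (log w * 2⁻¹).im = arg w / 2 := by
          rw [mul_im, log_im]; simp; ring
        rw [this]; linarith
      · have h1 : arg w ≤ π := arg_le_pi w
        have : (log w * 2⁻¹).im = arg w / 2 := by
          rw [mul_im, log_im]; simp; ring
        rw [this]; linarith
  -- `(Re q)² - (Im q)² = Re w` and `(Re q)² + (Im q)² = ‖w‖`
  have h1 : q.re ^ 2 - q.im ^ 2 = w.re := by
    have := congrArg Complex.re hq2
    rw [sq, mul_re] at this
    nlinarith [this]
  have h2 : q.re ^ 2 + q.im ^ 2 = ‖w‖ := by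
    have h3 : ‖q‖ ^ 2 = ‖w‖ := by rw [← norm_pow, hq2]
    rw [Complex.sq_norm, Complex.normSq_apply] at h3
    nlinarith [h3]
  have h4 : ‖w‖ / 2 ≤ q.re ^ 2 := by linarith
  calc Real.sqrt (‖w‖ / 2) ≤ Real.sqrt (q.re ^ 2) := Real.sqrt_le_sqrt h4
    _ = q.re := Real.sqrt_sq hre0

/-- `‖w^{1/2}‖² = ‖w‖`. [folklore] -/
theorem norm_cpow_half_sq (w : ℂ) : ‖w ^ (2⁻¹ : ℂ)‖ ^ 2 = ‖w‖ := by
  rw [← norm_pow, cpow_ofNat_inv_pow w 2]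

/-- `(1+x²)^{1/4} = √(√(1+x²))`. [folklore] -/
theorem rpow_quarter_eq_sqrt_sqrt (x : ℝ) : (1 + x ^ 2) ^ (1 / 4 : ℝ) = Real.sqrt (Real.sqrt (1 + x ^ 2)) := by
  rw [Real.sqrt_eq_rpow, Real.sqrt_eq_rpow, ← Real.rpow_mul (by positivity)]
  norm_num

/-- **The damping factor is holomorphic on `{Im z > -1}`.** [folklore] -/
theorem differentiableAt_sqrtDamping (a : ℝ) {z : ℂ} (hz : -1 < z.im) :
    DifferentiableAt ℂ (fun z : ℂ => cexp (-(a : ℂ) * (1 - I * z) ^ (2⁻¹ : ℂ))) z := by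
  have h1 : DifferentiableAt ℂ (fun z : ℂ => 1 - I * z) z := by fun_prop
  exact ((h1.cpow_const (one_sub_I_mul_mem_slitPlane hz)).const_mul _).cexp

/-- **Decay on horizontal lines**: for `a > 0` and `Im z ≥ 0`,
`‖exp(-a (1 - iz)^{1/2})‖ ≤ exp(-(a/2) (1 + (Re z)²)^{1/4})`. [folklore] -/
theorem norm_sqrtDamping_le {a : ℝ} (ha : 0 < a) {z : ℂ} (hz : 0 ≤ z.im) :
    ‖cexp (-(a : ℂ) * (1 - I * z) ^ (2⁻¹ : ℂ))‖ ≤ Real.exp (-(a / 2) * (1 + z.re ^ 2) ^ (1 / 4 : ℝ)) := by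
  set w : ℂ := 1 - I * z with hw
  have hwre : 0 ≤ w.re := by rw [hw, (one_sub_I_mul_re_im z).1]; linarith
  rw [Complex.norm_exp, Real.exp_le_exp]
  have hre : (-(a : ℂ) * w ^ (2⁻¹ : ℂ)).re = -a * (w ^ (2⁻¹ : ℂ)).re := by
    rw [neg_mul, neg_re, mul_re, ofReal_re, ofReal_im]; ring
  rw [hre]
  have h1 := sqrt_norm_div_two_le_re_cpow_half hwre
  -- `‖w‖ ≥ √(1 + x²)`
  have h2 : Real.sqrt (1 + z.re ^ 2) ≤ ‖w‖ := by
    rw [Real.sqrt_le_left (norm_nonneg _), hw, norm_sq_one_sub_I_mul]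
    nlinarith
  -- `√(‖w‖/2) ≥ (1+x²)^{1/4}/√2 ≥ (1+x²)^{1/4}/2`
  have h3 : (1 + z.re ^ 2) ^ (1 / 4 : ℝ) / 2 ≤ Real.sqrt (‖w‖ / 2) := by
    rw [rpow_quarter_eq_sqrt_sqrt]
    have h4 : Real.sqrt (Real.sqrt (1 + z.re ^ 2) / 4) ≤ Real.sqrt (‖w‖ / 2) :=
      Real.sqrt_le_sqrt (by linarith [Real.sqrt_nonneg (1 + z.re ^ 2)])
    have h5 : Real.sqrt (Real.sqrt (1 + z.re ^ 2) / 4) = Real.sqrt (Real.sqrt (1 + z.re ^ 2)) / 2 := by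
      rw [Real.sqrt_div' _ (by norm_num : (0:ℝ) ≤ 4), show (4 : ℝ) = 2 ^ 2 by norm_num,
        Real.sqrt_sq (by norm_num)]
    linarith
  nlinarith [Real.rpow_nonneg (by positivity : (0 : ℝ) ≤ 1 + z.re ^ 2) (1 / 4)]

/-- `‖exp(-a (1 - iz)^{1/2})‖ ≤ 1` for `a ≥ 0`, `Im z ≥ -1`. [folklore] -/
theorem norm_sqrtDamping_le_one {a : ℝ} (ha : 0 ≤ a) {z : ℂ} (hz : -1 ≤ z.im) :
    ‖cexp (-(a : ℂ) * (1 - I * z) ^ (2⁻¹ : ℂ))‖ ≤ 1 := by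
  set w : ℂ := 1 - I * z with hw
  have hwre : 0 ≤ w.re := by rw [hw, (one_sub_I_mul_re_im z).1]; linarith
  rw [Complex.norm_exp, Real.exp_le_one_iff]
  have hre : (-(a : ℂ) * w ^ (2⁻¹ : ℂ)).re = -a * (w ^ (2⁻¹ : ℂ)).re := by
    rw [neg_mul, neg_re, mul_re, ofReal_re, ofReal_im]; ring
  rw [hre]
  have h1 := sqrt_norm_div_two_le_re_cpow_half hwre
  have h2 : 0 ≤ (w ^ (2⁻¹ : ℂ)).re := (Real.sqrt_nonneg _).trans h1
  nlinarith

/-- **Lower bound on `[-1, 1]`**: `‖exp(-a (1 - ix)^{1/2})‖ ≥ e^{-2a}` for real `|x| ≤ 1`, `a ≥ 0`.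
[folklore] -/
theorem norm_sqrtDamping_real_ge {a : ℝ} (ha : 0 ≤ a) {x : ℝ} (hx : |x| ≤ 1) :
    Real.exp (-(2 * a)) ≤ ‖cexp (-(a : ℂ) * (1 - I * (x : ℂ)) ^ (2⁻¹ : ℂ))‖ := by
  set w : ℂ := 1 - I * (x : ℂ) with hw
  rw [Complex.norm_exp, Real.exp_le_exp]
  have hre : (-(a : ℂ) * w ^ (2⁻¹ : ℂ)).re = -a * (w ^ (2⁻¹ : ℂ)).re := by
    rw [neg_mul, neg_re, mul_re, ofReal_re, ofReal_im]; ring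
  rw [hre]
  -- `Re q ≤ ‖q‖ ≤ 2`
  have h1 : (w ^ (2⁻¹ : ℂ)).re ≤ ‖w ^ (2⁻¹ : ℂ)‖ := re_le_norm _
  have h2 : ‖w ^ (2⁻¹ : ℂ)‖ ≤ 2 := by
    have h3 : ‖w ^ (2⁻¹ : ℂ)‖ ^ 2 = ‖w‖ := norm_cpow_half_sq w
    have h4 : ‖w‖ ^ 2 = (1 + (0 : ℝ)) ^ 2 + x ^ 2 := by
      rw [hw, norm_sq_one_sub_I_mul]; simp
    have h5 : ‖w‖ ≤ 2 := by
      have hx2 : x ^ 2 ≤ 1 := by rw [← sq_abs]; nlinarith [abs_nonneg x]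
      nlinarith [norm_nonneg w]
    nlinarith [norm_nonneg (w ^ (2⁻¹ : ℂ))]
  nlinarith

/-- **Polar form on the real line**: `E(x) = ‖E(x)‖ · exp(i b(x))` with
`b(x) = -a Im (1 - ix)^{1/2}`. [folklore] -/
theorem sqrtDamping_real_eq_norm_mul_exp (a x : ℝ) :
    cexp (-(a : ℂ) * (1 - I * (x : ℂ)) ^ (2⁻¹ : ℂ)) =
      (‖cexp (-(a : ℂ) * (1 - I * (x : ℂ)) ^ (2⁻¹ : ℂ))‖ : ℂ) *
        cexp (((-a * ((1 - I * (x : ℂ)) ^ (2⁻¹ : ℂ)).im : ℝ) : ℂ) * I) := by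
  set u : ℂ := -(a : ℂ) * (1 - I * (x : ℂ)) ^ (2⁻¹ : ℂ) with hu
  have hure : u.re = -a * ((1 - I * (x : ℂ)) ^ (2⁻¹ : ℂ)).re := by
    rw [hu, neg_mul, neg_re, mul_re, ofReal_re, ofReal_im]; ring
  have huim : u.im = -a * ((1 - I * (x : ℂ)) ^ (2⁻¹ : ℂ)).im := by
    rw [hu, neg_mul, neg_im, mul_im, ofReal_re, ofReal_im]; ring
  rw [Complex.norm_exp, ← huim]
  conv_lhs => rw [← re_add_im u, Complex.exp_add]
  rw [Complex.ofReal_exp]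

/-- The complex derivative of `z ↦ (1 - iz)^{1/2}`. [folklore] -/
theorem hasDerivAt_cpow_half_one_sub_I_mul {z : ℂ} (hz : -1 < z.im) :
    HasDerivAt (fun z : ℂ => (1 - I * z) ^ (2⁻¹ : ℂ))
      (2⁻¹ * (1 - I * z) ^ ((2⁻¹ : ℂ) - 1) * (-I)) z := by
  have h1 : HasDerivAt (fun z : ℂ => 1 - I * z) (-I) z := by
    simpa using ((hasDerivAt_id z).const_mul I).const_sub 1
  exact h1.cpow_const (one_sub_I_mul_mem_slitPlane hz)

/-- The derivative has norm `≤ 1/2` on the closed upper half-plane. [folklore] -/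
theorem norm_deriv_cpow_half_le {z : ℂ} (hz : 0 ≤ z.im) :
    ‖(2⁻¹ : ℂ) * (1 - I * z) ^ ((2⁻¹ : ℂ) - 1) * (-I)‖ ≤ 1 / 2 := by
  set w : ℂ := 1 - I * z with hw
  have hw0 : w ≠ 0 := by
    intro h
    have := congrArg Complex.re h
    rw [hw, (one_sub_I_mul_re_im z).1, zero_re] at this
    linarith
  have hnorm1 : 1 ≤ ‖w‖ := by
    have h1 : 1 ≤ ‖w‖ ^ 2 := by rw [hw, norm_sq_one_sub_I_mul]; nlinarith
    nlinarith [norm_nonneg w]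
  rw [norm_mul, norm_mul, norm_neg, norm_I, mul_one, norm_inv, Complex.norm_ofNat,
    norm_cpow_of_ne_zero hw0]
  have hexp : ((2⁻¹ : ℂ) - 1).re = -(1 / 2 : ℝ) := by norm_num
  have him : ((2⁻¹ : ℂ) - 1).im = 0 := by norm_num
  rw [hexp, him, mul_zero, Real.exp_zero, div_one]
  have h2 : ‖w‖ ^ (-(1 / 2 : ℝ)) ≤ 1 := by
    rw [Real.rpow_neg (norm_nonneg _)]
    exact inv_le_one_of_one_le₀ (Real.one_le_rpow hnorm1 (by norm_num))
  linarith

/-- **The boundary phase `b(x) = -a Im (1 - ix)^{1/2}` is `(a/2)`-Lipschitz** (`a ≥ 0`).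
[folklore] -/
theorem abs_sqrtDamping_phase_sub_le {a : ℝ} (ha : 0 ≤ a) (x₁ x₂ : ℝ) :
    |(-a * ((1 - I * (x₁ : ℂ)) ^ (2⁻¹ : ℂ)).im) - (-a * ((1 - I * (x₂ : ℂ)) ^ (2⁻¹ : ℂ)).im)| ≤
      a / 2 * |x₁ - x₂| := by
  -- the real-variable function `f(x) = (1 - ix)^{1/2}` is `(1/2)`-Lipschitz
  set f : ℝ → ℂ := fun x => (1 - I * (x : ℂ)) ^ (2⁻¹ : ℂ) with hf
  have hderiv : ∀ x : ℝ, HasDerivAt f (2⁻¹ * (1 - I * (x : ℂ)) ^ ((2⁻¹ : ℂ) - 1) * (-I)) x := by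
    intro x
    have h := hasDerivAt_cpow_half_one_sub_I_mul (z := (x : ℂ)) (by simp)
    exact h.comp_ofReal
  have hLip : ‖f x₁ - f x₂‖ ≤ (1 / 2) * ‖x₁ - x₂‖ := by
    refine Convex.norm_image_sub_le_of_norm_hasDerivWithin_le (s := univ)
      (fun x _ => (hderiv x).hasDerivWithinAt) (fun x _ => ?_) convex_univ (mem_univ x₂) (mem_univ x₁)
    exact norm_deriv_cpow_half_le (by simp)
  rw [Real.norm_eq_abs] at hLip
  have h1 : |(f x₁).im - (f x₂).im| ≤ ‖f x₁ - f x₂‖ := by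
    rw [← sub_im]; exact abs_im_le_norm _
  rw [show (-a * (f x₁).im) - (-a * (f x₂).im) = -a * ((f x₁).im - (f x₂).im) by ring, abs_mul,
    abs_neg, abs_of_nonneg ha]
  calc a * |(f x₁).im - (f x₂).im| ≤ a * ((1 / 2) * |x₁ - x₂|) :=
        mul_le_mul_of_nonneg_left (h1.trans hLip) ha
    _ = a / 2 * |x₁ - x₂| := by ring

/-- Continuity of the boundary phase. [folklore] -/
theorem continuous_sqrtDamping_phase (a : ℝ) :
    Continuous fun x : ℝ => -a * ((1 - I * (x : ℂ)) ^ (2⁻¹ : ℂ)).im := by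
  refine continuous_const.mul (Complex.continuous_im.comp ?_)
  refine continuous_iff_continuousAt.2 fun x => ?_
  exact ((hasDerivAt_cpow_half_one_sub_I_mul (z := (x : ℂ)) (by simp)).comp_ofReal).continuousAt

/-- Continuity of the damping factor at real points along any approach in `ℂ`. [folklore] -/
theorem continuousAt_sqrtDamping (a : ℝ) {z : ℂ} (hz : -1 < z.im) :
    ContinuousAt (fun z : ℂ => cexp (-(a : ℂ) * (1 - I * z) ^ (2⁻¹ : ℂ))) z :=
  (differentiableAt_sqrtDamping a hz).continuousAt

end SqrtDamping

end Literature.Analysis.Fourier
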